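import Summits.AtomisticToContinuum.HydrodynamicLimit.Theorems.LambertianContactSwapLambertianEulerMarkov
import Literature.MathematicalPhysics.KineticTheory.LambertianRedrawNondegenerate
import Literature.MathematicalPhysics.KineticTheory.HardSphereEuler
import HarnessLib

/-!
# A fresh redraw under `P ⊗ γ^ℕ` with a past-measurable weight (time ledger, part I)

Helper file (`--supports`) of the crux `LambertianEuler` of route `LambertianContactSwap`
(`AtomisticToContinuum/HydrodynamicLimit`, stmt-AtomisticToContinuum-11854), line `Sketch`,
sub-goal `timeLedgerLambda` (rung (T) of the tails memo, stub `stub_tailsLambda`): the expected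
`2k`-th velocity moment along the Lambertian flow `Λ` between two times changes by at most the
expected sum of the pair-Povzner increments of the collisions counted in between. Its collision-
indexed form is the landed ledger `momentLedger_chain`
(`…LambertianContactSwapLambertianEulerMomentLedgerChain`), whose transport lemma
`integral_stateAfter_succ_le_of_step` integrates the one-step conditional bound at the `m`-th state
over the FRESH `m`-th redraw, for a fixed datum. Re-indexing by time needs the same transport

* under an initial LAW `P` of the datum (the measure `P ⊗ γ^ℕ` on (datum, noise)), and
* with a WEIGHT `1_A` that is measurable with respect to the past of the `m`-th collision — here:
  determined by the datum and the first `m` redraws (the window events `{s < t_{m+1} ≤ s'}` of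
  part II are of this kind, `lambertInstant_congr`; locality of the states:
  `lambertStateAfter_congr`, both of `…LambertianContactSwapLambertianEulerMarkov`).

This file proves exactly that:

* `lintegral_prod_lambertNoise_truncAt` — Tonelli form of "the `n`-th redraw is fresh given the
  datum and the redraws below `n`" under `P ⊗ γ^ℕ` (Tonelli over `P`, then independence of the
  truncation below `n` and the tail from `n` of the i.i.d. sequence, the Tonelli identity
  `lintegral_truncAt_tailFrom` of `…LambertianContactSwapLambertianEulerMarkov`, read at the first
  coordinate of the tail);
* `integral_indicator_stateAfter_succ_le` (any dimension, regular measurable geometry) and its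
  registered form `lambert_integral_indicator_stateAfter_succ_le` on `𝕋³` — **weighted
  transport**: `E[1_A M(z_{m+1})] ≤ E[1_A (M(z_m) + I(z_m))]` whenever
  `E_ξ[M(lambertStep ξ z_m)] ≤ M(z_m) + I(z_m)` at a.e. visited `z_m`, for measurable `M ≥ 0` and
  `A` determined by (datum, first `m` redraws).

All [folklore] (strong Markov property of i.i.d. redraws at a deterministic index); no
definitions, no named facts.
-/

noncomputable section

open scoped BigOperators Topology ENNReal InnerProductSpace
open MeasureTheory ProbabilityTheory Filter Set
open Literature.MathematicalPhysics.KineticTheory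
open Literature.Analysis.FluidPDE Literature.Analysis.FluidPDE.Alexander

namespace Summit.AtomisticToContinuum.HydrodynamicLimit.Theorems.LambertianContactSwapLambertianEulerTimeLedgerFresh

open Summit.AtomisticToContinuum.HydrodynamicLimit.Theorems.LambertianContactSwapLambertianEulerMarkov

/-! ## A fresh redraw under `P ⊗ γ^ℕ`, with a past-measurable weight -/

section Fresh

variable {d : Type*} [Fintype d] {C : Type*} [MeasurableSpace C]

/-- **The `n`-th redraw is fresh given the datum and the redraws below `n`** (Tonelli form under
`P ⊗ γ^ℕ`): for a measurable `Φ ≥ 0` of ((datum, truncated noise), one redraw),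
`∫ Φ((z, ξs|<n), ξs n) d(P ⊗ γ^ℕ) = ∫ (∫ Φ((z, ξs|<n), ξ) dγ(ξ)) d(P ⊗ γ^ℕ)` — Tonelli over `P`,
then independence of the truncation below `n` and the tail from `n` of the i.i.d. sequence
(`lintegral_truncAt_tailFrom`), read at the first coordinate of the tail. [folklore] -/
theorem lintegral_prod_lambertNoise_truncAt (P : Measure C) (n : ℕ)
    {Φ : (C × (ℕ → EuclideanSpace ℝ d)) × EuclideanSpace ℝ d → ℝ≥0∞} (hΦ : Measurable Φ) :
    ∫⁻ p, Φ ((p.1, fun i => if i < n then p.2 i else 0), p.2 n) ∂(P.prod (lambertNoise d)) =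
      ∫⁻ p, (∫⁻ ξ, Φ ((p.1, fun i => if i < n then p.2 i else 0), ξ)
        ∂(stdGaussian (EuclideanSpace ℝ d))) ∂(P.prod (lambertNoise d)) := by
  have hT : Measurable fun p : C × (ℕ → EuclideanSpace ℝ d) =>
      ((p.1, fun i => if i < n then p.2 i else 0) : C × (ℕ → EuclideanSpace ℝ d)) :=
    measurable_fst.prodMk ((measurable_truncAt d n).comp measurable_snd)
  have h1 : Measurable fun p : C × (ℕ → EuclideanSpace ℝ d) =>
      Φ ((p.1, fun i => if i < n then p.2 i else 0), p.2 n) :=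
    hΦ.comp (hT.prodMk ((measurable_pi_apply n).comp measurable_snd))
  have h2 : Measurable fun p : C × (ℕ → EuclideanSpace ℝ d) =>
      ∫⁻ ξ, Φ ((p.1, fun i => if i < n then p.2 i else 0), ξ)
        ∂(stdGaussian (EuclideanSpace ℝ d)) :=
    hΦ.lintegral_prod_right'.comp hT
  rw [lintegral_prod _ h1.aemeasurable, lintegral_prod _ h2.aemeasurable]
  refine lintegral_congr fun z => ?_
  have hF : Measurable fun q : (ℕ → EuclideanSpace ℝ d) × (ℕ → EuclideanSpace ℝ d) =>
      Φ ((z, q.1), q.2 0) :=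
    hΦ.comp ((measurable_const.prodMk measurable_fst).prodMk
      ((measurable_pi_apply 0).comp measurable_snd))
  have h := lintegral_truncAt_tailFrom d n (F := fun x y => Φ ((z, x), y 0)) hF
  simp only [zero_add] at h
  rw [h]
  refine lintegral_congr fun ξs => ?_
  dsimp only
  have hmap : (lambertNoise d).map (fun ηs : ℕ → EuclideanSpace ℝ d => ηs 0) =
      stdGaussian (EuclideanSpace ℝ d) :=
    Measure.infinitePi_map_eval (fun _ : ℕ => stdGaussian (EuclideanSpace ℝ d)) 0
  have hm : Measurable fun ξ : EuclideanSpace ℝ d =>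
      Φ ((z, fun i => if i < n then ξs i else 0), ξ) :=
    hΦ.comp (measurable_const.prodMk measurable_id)
  rw [← hmap, lintegral_map hm (measurable_pi_apply 0)]

variable {X : Type*} {N : ℕ} [TopologicalSpace X] [MeasurableSpace X] {G : Geometry d X} {ε : ℝ}

/-- **Weighted transport of a one-step conditional ledger along the Lambertian recursion, under
an initial law `P`.** Let `M ≥ 0` be measurable, `I` any functional of the state, and `A` a
measurable event of (datum, noise) which is *determined by the datum and the first `m` redraws*
(membership is unchanged when the noise is truncated below `m`). If at `P ⊗ γ^ℕ`-a.e. visited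
`m`-th state `w = z_m` the Gaussian average of `M` after one more step is at most `M(w) + I(w)`,
then `E[1_A M(z_{m+1})] ≤ E[1_A (M(z_m) + I(z_m))]`: the `m`-th redraw is fresh given the datum and
the past redraws (`lintegral_prod_lambertNoise_truncAt`), and `z_m`, `A` are functions of those
(`lambertStateAfter_congr`). The unweighted, fixed-datum case is
`integral_stateAfter_succ_le_of_step`. [folklore] -/
theorem integral_indicator_stateAfter_succ_le (hG : G.IsHardSphereRegular ε) (hGm : G.IsMeasurable)
    {M I : Config N d X → ℝ} (hMm : Measurable M) (hM0 : ∀ w, 0 ≤ M w) (m : ℕ)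
    (P : Measure (Config N d X)) {A : Set (Config N d X × (ℕ → EuclideanSpace ℝ d))}
    (hA : MeasurableSet A)
    (hAloc : ∀ p : Config N d X × (ℕ → EuclideanSpace ℝ d),
      ((p.1, fun i => if i < m then p.2 i else 0) : Config N d X × (ℕ → EuclideanSpace ℝ d)) ∈ A ↔
        p ∈ A)
    (hint : Integrable (A.indicator fun p => M (lambertStateAfter G ε p.2 p.1 m) +
      I (lambertStateAfter G ε p.2 p.1 m)) (P.prod (lambertNoise d)))
    (hstep : ∀ᵐ p ∂(P.prod (lambertNoise d)),
      Integrable (fun ξ => M (lambertStep G ε ξ (lambertStateAfter G ε p.2 p.1 m)))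
          (stdGaussian (EuclideanSpace ℝ d)) ∧
        ∫ ξ, M (lambertStep G ε ξ (lambertStateAfter G ε p.2 p.1 m))
            ∂(stdGaussian (EuclideanSpace ℝ d)) ≤
          M (lambertStateAfter G ε p.2 p.1 m) + I (lambertStateAfter G ε p.2 p.1 m)) :
    ∫ p, A.indicator (fun p => M (lambertStateAfter G ε p.2 p.1 (m + 1))) p
        ∂(P.prod (lambertNoise d)) ≤
      ∫ p, A.indicator (fun p => M (lambertStateAfter G ε p.2 p.1 m) +
        I (lambertStateAfter G ε p.2 p.1 m)) p ∂(P.prod (lambertNoise d)) := by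
  classical
  have hZ : Measurable fun p : Config N d X × (ℕ → EuclideanSpace ℝ d) =>
      lambertStateAfter G ε p.2 p.1 m := measurable_lambertStateAfter hG hGm m
  have hZ1 : Measurable fun p : Config N d X × (ℕ → EuclideanSpace ℝ d) =>
      lambertStateAfter G ε p.2 p.1 (m + 1) := measurable_lambertStateAfter hG hGm (m + 1)
  have hΦ : Measurable fun r : (Config N d X × (ℕ → EuclideanSpace ℝ d)) × EuclideanSpace ℝ d =>
      if r.1 ∈ A then
        ENNReal.ofReal (M (lambertStep G ε r.2 (lambertStateAfter G ε r.1.2 r.1.1 m)))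
      else 0 := by
    refine Measurable.ite (measurable_fst hA) ?_ measurable_const
    exact (hMm.comp (measurable_lambertStep_comp hG hGm (hZ.comp measurable_fst)
      measurable_snd)).ennreal_ofReal
  have hZloc : ∀ p : Config N d X × (ℕ → EuclideanSpace ℝ d),
      lambertStateAfter G ε (fun i => if i < m then p.2 i else 0) p.1 m =
        lambertStateAfter G ε p.2 p.1 m :=
    fun p => lambertStateAfter_congr (fun i hi => if_pos hi) le_rfl
  have hchain :
      ∫⁻ p, ENNReal.ofReal (A.indicator (fun p => M (lambertStateAfter G ε p.2 p.1 (m + 1))) p)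
          ∂(P.prod (lambertNoise d)) ≤
        ∫⁻ p, ENNReal.ofReal (A.indicator (fun p => M (lambertStateAfter G ε p.2 p.1 m) +
          I (lambertStateAfter G ε p.2 p.1 m)) p) ∂(P.prod (lambertNoise d)) := by
    calc ∫⁻ p, ENNReal.ofReal (A.indicator (fun p => M (lambertStateAfter G ε p.2 p.1 (m + 1))) p)
          ∂(P.prod (lambertNoise d))
        = ∫⁻ p, (if ((p.1, fun i => if i < m then p.2 i else 0) :
              Config N d X × (ℕ → EuclideanSpace ℝ d)) ∈ A then
            ENNReal.ofReal (M (lambertStep G ε (p.2 m)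
              (lambertStateAfter G ε (fun i => if i < m then p.2 i else 0) p.1 m))) else 0)
            ∂(P.prod (lambertNoise d)) := by
          refine lintegral_congr fun p => ?_
          rw [hZloc p, ← lambertStateAfter_succ]
          by_cases hp : p ∈ A
          · rw [indicator_of_mem hp, if_pos ((hAloc p).2 hp)]
          · rw [indicator_of_notMem hp, if_neg (fun h => hp ((hAloc p).1 h)), ENNReal.ofReal_zero]
      _ = ∫⁻ p, (∫⁻ ξ, (if ((p.1, fun i => if i < m then p.2 i else 0) :
              Config N d X × (ℕ → EuclideanSpace ℝ d)) ∈ A then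
            ENNReal.ofReal (M (lambertStep G ε ξ
              (lambertStateAfter G ε (fun i => if i < m then p.2 i else 0) p.1 m))) else 0)
            ∂(stdGaussian (EuclideanSpace ℝ d))) ∂(P.prod (lambertNoise d)) :=
          lintegral_prod_lambertNoise_truncAt P m hΦ
      _ = ∫⁻ p, A.indicator (fun p => ∫⁻ ξ, ENNReal.ofReal (M (lambertStep G ε ξ
            (lambertStateAfter G ε p.2 p.1 m))) ∂(stdGaussian (EuclideanSpace ℝ d))) p
            ∂(P.prod (lambertNoise d)) := by
          refine lintegral_congr fun p => ?_
          rw [hZloc p]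
          by_cases hp : p ∈ A
          · simp only [if_pos ((hAloc p).2 hp), indicator_of_mem hp]
          · simp only [if_neg (fun h => hp ((hAloc p).1 h)), indicator_of_notMem hp,
              lintegral_zero]
      _ ≤ _ := lintegral_mono_ae ?_
    filter_upwards [hstep] with p hp
    by_cases hpA : p ∈ A
    · rw [indicator_of_mem hpA, indicator_of_mem hpA,
        ← ofReal_integral_eq_lintegral_ofReal hp.1 (Eventually.of_forall fun ξ => hM0 _)]
      exact ENNReal.ofReal_le_ofReal hp.2
    · rw [indicator_of_notMem hpA, indicator_of_notMem hpA, ENNReal.ofReal_zero]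
  have hG0 : 0 ≤ᵐ[P.prod (lambertNoise d)] A.indicator (fun p =>
      M (lambertStateAfter G ε p.2 p.1 m) + I (lambertStateAfter G ε p.2 p.1 m)) := by
    filter_upwards [hstep] with p hp
    exact Set.indicator_apply_nonneg fun _ => (integral_nonneg fun ξ => hM0 _).trans hp.2
  have hL : AEStronglyMeasurable (fun p => A.indicator (fun p =>
      M (lambertStateAfter G ε p.2 p.1 (m + 1))) p) (P.prod (lambertNoise d)) :=
    ((hMm.comp hZ1).indicator hA).aestronglyMeasurable
  have hL0 : 0 ≤ᵐ[P.prod (lambertNoise d)] fun p => A.indicator (fun p =>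
      M (lambertStateAfter G ε p.2 p.1 (m + 1))) p :=
    Eventually.of_forall fun p => Set.indicator_apply_nonneg fun _ => hM0 _
  rw [integral_eq_lintegral_of_nonneg_ae hL0 hL,
    ← ENNReal.toReal_ofReal (integral_nonneg_of_ae hG0)]
  exact ENNReal.toReal_mono ENNReal.ofReal_ne_top
    (hchain.trans_eq (ofReal_integral_eq_lintegral_ofReal hint hG0).symm)

end Fresh

/-! ## Registered form on `𝕋³` -/

/-- **Weighted transport of a one-step conditional ledger along the Lambertian recursion on
`𝕋³`, under an initial law `P`** (registered sub-goal
`lambert_integral_indicator_stateAfter_succ_le` of `timeLedgerLambda`, line `Sketch`; term-style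
statement): for a regular measurable geometry `G` on `𝕋³`, measurable `M ≥ 0`, any `I`, an
index `m`, a law `P` of the datum and a measurable event `A` of (datum, noise) determined by the
datum and the first `m` redraws, if
`1_A (M(z_m) + I(z_m))` is integrable and `E_ξ[M(lambertStep ξ z_m)] ≤ M(z_m) + I(z_m)` at
`P ⊗ γ^ℕ`-a.e. `z_m` (with the Gaussian average finite), then
`E[1_A M(z_{m+1})] ≤ E[1_A (M(z_m) + I(z_m))]`. [folklore] -/
theorem lambert_integral_indicator_stateAfter_succ_le :
    ∀ {N : ℕ} {G : Geometry (Fin 3) T3} {ε : ℝ}, G.IsHardSphereRegular ε → G.IsMeasurable →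
    ∀ {M I : Config N (Fin 3) T3 → ℝ}, Measurable M → (∀ w, 0 ≤ M w) →
    ∀ (m : ℕ) (P : Measure (Config N (Fin 3) T3)) {A : Set (Config N (Fin 3) T3 × (ℕ → V3))},
      MeasurableSet A →
      (∀ p : Config N (Fin 3) T3 × (ℕ → V3),
        ((p.1, fun i => if i < m then p.2 i else 0) : Config N (Fin 3) T3 × (ℕ → V3)) ∈ A ↔ p ∈ A) →
      Integrable (A.indicator fun p => M (lambertStateAfter G ε p.2 p.1 m) +
        I (lambertStateAfter G ε p.2 p.1 m)) (P.prod (lambertNoise (Fin 3))) →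
      (∀ᵐ p ∂(P.prod (lambertNoise (Fin 3))),
        Integrable (fun ξ => M (lambertStep G ε ξ (lambertStateAfter G ε p.2 p.1 m)))
            (stdGaussian V3) ∧
          ∫ ξ, M (lambertStep G ε ξ (lambertStateAfter G ε p.2 p.1 m)) ∂(stdGaussian V3) ≤
            M (lambertStateAfter G ε p.2 p.1 m) + I (lambertStateAfter G ε p.2 p.1 m)) →
      ∫ p, A.indicator (fun p => M (lambertStateAfter G ε p.2 p.1 (m + 1))) p
          ∂(P.prod (lambertNoise (Fin 3))) ≤
        ∫ p, A.indicator (fun p => M (lambertStateAfter G ε p.2 p.1 m) +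
          I (lambertStateAfter G ε p.2 p.1 m)) p ∂(P.prod (lambertNoise (Fin 3))) :=
  fun hG hGm _ _ hMm hM0 m P _ hA hAloc hint hstep =>
    integral_indicator_stateAfter_succ_le hG hGm hMm hM0 m P hA hAloc hint hstep

end Summit.AtomisticToContinuum.HydrodynamicLimit.Theorems.LambertianContactSwapLambertianEulerTimeLedgerFresh

end
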